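import Summits.BirchSwinnertonDyer.Rank2.CountingDoorKernel
import Literature.NumberTheory.EllipticCurves.CanonicalPAdicHeightIntegralityProofs
import Literature.NumberTheory.EllipticCurves.IwasawaLeadingTermProofs
import HarnessLib

/-!
# Cell bsd-rank2 (TWIN currency, door D-λ at a NON-ANOMALOUS prime): the λ-DOOR KERNEL —
# integrality of the canonical cyclotomic `p`-adic height (Mazur–Tate 1983) and
# "`[T^r] f_E ∈ ℤ_pˣ` ⟹ `rank = ord_T f_E = r`, `Ш[p^∞] = 0`, `Reg_p/p^r ∈ ℤ_pˣ`" (theorems only)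

Cell-side file (cell bsd-rank2, seat bsd-rank2-lit GEN 11; serves the p2 lane's λ-door at a
non-anomalous good ordinary prime, `HOME/STATUS.md` 2026-08-26T10:05:53Z (2), and the eng lane's
table `HOME/bsd-rank2-eng/data/f2door/LAMBDA5.md`). Companion of `CountingDoorKernel.lean` (door
D-count). Everything is PROVED from tree theorems; the ONE published input that is still a NAMED FACT
enters as an explicit hypothesis, by name: `Schneider1985_order_charGenerator_odd` (Schneider 1985
Thm 2′ / Perrin-Riou / BMS Thm 1.7 / SW13 Thm 6.1 at odd `p`). No new definition, no named fact, no
instance.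

## The printed argument

* **Integrality (Mazur–Tate 1983, §3.3 (display after (3.3.4)), (4.1.1)–(4.1.2), §1.2, (4.4)
  Prop.).** The canonical `ρ`-pairing takes values in
  `Σ_{v∈S} (1/m_{A_v})[ρ_v(K_v^*) + (1/(m_{B_v} n_{A_v} n_{B_v})) ρ_v(𝔬_v^*)] + Σ_{v∉S} (1/m_{A_v}) ρ_v(K_v^*)`,
  `m_{A_v}` the exponent of the component group, `n_{A_v}` that of `Ẽ(k_v)`; for `E/ℚ`, the
  cyclotomic `ρ_c = log_p ∘ χ` (`S = {p}`, `ρ_v(ℚ_v^*) ⊆ log_p(ℚ_p^×) = pℤ_p`, `p` odd) and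
  Schneider's height = the `ρ_c`-pairing ((4.4) Prop.) = the tree's canonical datum
  (`PAdicHeightData.IsCanonical`, Stein–Wuthrich (4.1) = `−2p ×` MST06 (1.1)), this reads
  `ord_p ⟨P, Q⟩ ≥ 1 − max(max_ℓ ord_p m_ℓ, 2 ord_p n_p)`; so on the class
  `𝒞_p = {a_p ≢ 1 (mod p), p ∤ [E(ℚ) : E(ℚ) ∩ E⁰(ℚ_ℓ)] ∀ℓ}` every value lies in `pℤ_p`. The proof
  below is the Mazur–Stein–Tate / Harvey form of the same statement: for an ADMISSIBLE point `Q`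
  (`Q ∈ E₁(ℚ_p)`, non-singular reduction everywhere) `ĥ_p(Q) = 2 log_p(e(Q)/σ_p(Q))` with
  `e/σ_p` a unit (tree theorem `PAdicHeightData.IsCanonical.norm_pairing_self_sub_padicLog_num_le`:
  `‖ĥ_p(Q) − log_p(num x(Q))‖ ≤ ‖x/y‖`), hence `ĥ_p(Q) ∈ pℤ_p`; every `P ∈ E(ℚ)` has the admissible
  multiple `m P`, `m = N_p · ∏_ℓ [E(ℚ) : E(ℚ) ∩ E⁰(ℚ_ℓ)]` (MST06 Alg. 3.4 step 1: "`m` could be the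
  least common multiple of the Tamagawa numbers of `E` and `#E(𝔽_p)`"), which is prime to `p` on
  `𝒞_p`, and `ĥ_p(P) = ĥ_p(mP)/m²`.
* **The door.** With `f_E` a characteristic element of `X(E/ℚ_∞)` and `r ≤ rank E(ℚ)`:
  `[T^r] f_E ∈ ℤ_pˣ` (i.e. `μ = 0 ∧ λ(f_E) = r`, Kundu–Ray II Lemma 3.4 in leading-coefficient form)
  and clause 1 of Schneider (`rank ≤ ord_T f_E`) give `rank = ord_T f_E = r`; clause 2 gives
  Schneider's conjecture and `Ш[p^∞]` finite; clause 3 (Schneider 1985 Thm 2′, p. 342),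
  `[T^r]f_E · log_p(γ)^r · #tors² = u · (1 − α⁻¹)² · #Ш[p^∞] · Reg_p · ∏ c_ℓ`, read in norms with
  `‖log_p γ‖ = p⁻¹`, `p ∤ #tors` (non-anomalous, AEC VII.3.1), `‖1 − α⁻¹‖ = ‖N_p‖ = 1`, `p ∤ ∏ c_ℓ`
  and the integrality `‖Reg_p‖ ≤ p^{-rank}`, forces `p ∤ #Ш[p^∞]` — so `Ш[p^∞] = 0` — and
  `‖Reg_p‖ = p^{-r}` exactly. Conversely `Ш[p^∞] = 0 ∧ ‖Reg_p‖ = p^{-rank}` gives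
  `[T^{rank}] f_E ∈ ℤ_pˣ`.

## What is here (all theorems; `W/ℚ` globally minimal elliptic, `p ≥ 3`)

The integrality half (Mazur–Tate 1983 §3.3: `‖⟨P,Q⟩‖ ≤ p⁻¹` on the class `𝒞_p`, `‖Reg_p‖ ≤ p^{-rank}`)
is the Literature proof file `Literature/NumberTheory/EllipticCurves/CanonicalPAdicHeightIntegralityProofs.lean`
(`WeierstrassCurve.norm_pairing_le_of_not_anomalous`, `…norm_padicRegulator_le_of_forall_norm_pairing_le`).
Here:

* `primaryComponent_sha_eq_bot_of_not_dvd_natCard` — a finite `Ш[p^∞]` of order prime to `p` is `0`.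
* `lambdaDoorKernel` — THE DOOR (modulo `Schneider1985_order_charGenerator_odd`), generator form:
  `IsUnit ([T^r] g)`, `r ≤ rank`, integrality of THE canonical height, `a_p ≢ 1 (mod p)`,
  `p ∤ ∏ c_ℓ` ⟹ `rank = r = ord_T g`, `Ш[p^∞] = ⊥`, Schneider's conjecture, `‖Reg_p‖ = p^{-r}`.
* `isUnit_coeff_of_sha_eq_bot_of_norm_padicRegulator_eq` — the converse: `Ш[p^∞] = ⊥` and
  `‖Reg_p‖ = p^{-rank}` ⟹ `[T^{rank}] g ∈ ℤ_pˣ` and `ord_T g = rank`. So on `𝒞_p` the λ-certificate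
  "`μ = 0 ∧ λ = rank`" is EQUIVALENT to "`Ш[p^∞] = 0 ∧ 𝓡_p ∈ ℤ_pˣ`" (CM prototype: Perrin-Riou's
  criterion, Coates 1983 Thm 17/24).
* `lambdaDoorKernel_of_not_anomalous` — the same with the integrality DISCHARGED by the Literature
  theorem (hypothesis `p ∤ [E(ℚ) : E(ℚ) ∩ E⁰(ℚ_ℓ)]` for all `ℓ` instead of `‖⟨P,Q⟩‖ ≤ p⁻¹`);
  `isUnit_coeff_iff_sha_eq_bot_and_norm_padicRegulator_eq` — the unit criterion as an `↔` on `𝒞_p`.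
* `lambdaDoorKernel_SU` — `g` read as the `p`-adic `L`-function through Skinner–Urban with
  `ρ_{E,p^n}` surjective for all `n` (exact main conjecture `ι g = L_p(f, α)`, no `p^k` ambiguity):
  `‖[T^r] L_p‖ = 1`, `r ≤ rank` ⟹ `rank = r = ord_T L_p`, `Ш[p^∞] = ⊥`, and the canonical regulator
  is non-zero of norm `p^{-r}`.

PARTITION: none — r_an ≥ 2, summit axis S0; TWIN (D-0056): n/a. B1 honesty: nothing here mentions
the analytic rank or the complex `L`-function; the `p`-adic `L`-function enters only through the
main conjecture (TWIN currency); S0 is not touched.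

## References

* B. Mazur, J. Tate, *Canonical height pairings via biextensions*, in: Arithmetic and Geometry I
  (Shafarevich Festschrift), Progr. Math. 35, Birkhäuser 1983, 195–237: §1.2 (exponents
  `m_A, n_A`), §3.3 (value subgroup of the canonical `ρ`-pairing), (4.1.1)–(4.1.2), (4.4) Prop.
  (= Schneider's height). [MazurTate1983Biext]
* B. Mazur, W. Stein, J. Tate, Doc. Math. Extra Vol. Coates (2006), §1 (1.1), Alg. 3.4 (steps 1, 4),
  §4 tables ("the regulator for p = 5 is not a unit, and #E(𝔽₅) = 9"). [MazurSteinTate2006]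
* D. Harvey, LMS J. Comput. Math. 11 (2008), §5. [Harvey2008]
* W. Stein, C. Wuthrich, Math. Comp. 82 (2013), §4 (4.1), §4.4 (`Reg_γ = Reg_p/log_p κ(γ)^r`),
  Thm 6.1. [SteinWuthrich2013]
* P. Schneider, Invent. Math. 79 (1985), Thm 2′ p. 342, Thm 7 p. 371. [Schneider1985]
* D. Kundu, A. Ray, IJNT 20 (2024) (arXiv:2106.12095), Lemma 3.4, Thm 3.6, (ecfshort). [KunduRay2024]
* J. Coates, *Infinite descent on elliptic curves with CM*, ibid. 107–137, Thm 17/24 (CM prototype). [Coates1983InfiniteDescent]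
* J. H. Silverman, AEC 2nd ed., VII.2.1, VII.3.1, VII.6.1. [SilvermanAEC2009]
-/

noncomputable section

open scoped Classical
open WeierstrassCurve Literature.NumberTheory.EllipticCurves
  Literature.NumberTheory.EllipticCurves.ModularForms CongruenceSubgroup

namespace Summit.BirchSwinnertonDyer.Rank2

/-! ### §1. A finite `Ш[p^∞]` of order prime to `p` is trivial -/

section Sha

variable {K : Type} [Field K] [NumberField K] (W : WeierstrassCurve K) (p : ℕ) [Fact p.Prime]

/-- **`p ∤ #Ш[p^∞] ⇒ Ш[p^∞] = 0`** (for `Ш[p^∞]` finite): an element of `Ш` killed by `p` lies in the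
`p`-primary part, where its order divides both `p` and `#Ш[p^∞]`, hence is `1`; and a `p`-primary
group without `p`-torsion is trivial (tree `primaryComponent_sha_eq_bot_of_forall`). [folklore] -/
theorem primaryComponent_sha_eq_bot_of_not_dvd_natCard
    [Finite (AddCommGroup.primaryComponent W.sha p)]
    (h : ¬ p ∣ Nat.card (AddCommGroup.primaryComponent W.sha p)) :
    AddCommGroup.primaryComponent W.sha p = ⊥ := by
  have hpp : p.Prime := Fact.out
  refine W.primaryComponent_sha_eq_bot_of_forall fun c hc hpc ↦ ?_
  set x : W.sha := ⟨c, hc⟩ with hx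
  have hpx : p • x = 0 := Subtype.ext (by simpa [hx] using hpc)
  have hxmem : x ∈ AddCommGroup.primaryComponent W.sha p :=
    (AddCommGroup.mem_primaryComponent).mpr ⟨1, by rw [pow_one]; exact hpx⟩
  set y : AddCommGroup.primaryComponent W.sha p := ⟨x, hxmem⟩ with hy
  have hpy : p • y = 0 := Subtype.ext (by simpa [hy] using hpx)
  have hdvd_p : addOrderOf y ∣ p := addOrderOf_dvd_of_nsmul_eq_zero hpy
  have hdvd_card : addOrderOf y ∣ Nat.card (AddCommGroup.primaryComponent W.sha p) :=
    addOrderOf_dvd_natCard y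
  rcases (Nat.dvd_prime hpp).mp hdvd_p with h1 | h1
  · have hy0 : y = 0 := AddMonoid.addOrderOf_eq_one_iff.mp h1
    have hx0 : x = 0 := by simpa [hy] using congrArg Subtype.val hy0
    simpa [hx] using congrArg Subtype.val hx0
  · rw [h1] at hdvd_card
    exact absurd hdvd_card h

end Sha

/-! ### §2. The λ-door kernel at a non-anomalous prime -/

section Door

variable (W : WeierstrassCurve ℚ) [W.IsElliptic] [W.IsGloballyMinimal] (p : ℕ) [Fact p.Prime]

/-- **THE λ-DOOR KERNEL (per member, generator form; modulo `Schneider1985_order_charGenerator_odd`).**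
Let `W/ℚ` be globally minimal elliptic, `p ≥ 3` good ordinary and NON-ANOMALOUS (`a_p ≢ 1 (mod p)`),
`p ∤ ∏_ℓ c_ℓ`; let `X(E/ℚ_∞)` be the cyclotomic Selmer dual (torsion, `char X = (g)`), `Dh` THE
canonical `p`-adic height datum whose pairing is `p`-INTEGRAL (`‖⟨P,Q⟩‖ ≤ p⁻¹`, supplied by
`norm_pairing_le_of_not_anomalous`), and `r ≤ rank E(ℚ)` with `[T^r] g ∈ ℤ_pˣ` (`⟺ μ = 0 ∧ λ(g) = r`).
Then `rank E(ℚ) = r = ord_T g`, `Ш(E/ℚ)[p^∞] = 0`, Schneider's conjecture holds for `Dh`, and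
`‖Reg_p(Dh)‖ = p^{-r}` (Kundu–Ray's `𝓡_p ∈ ℤ_pˣ`). Proof: clause 1 + `[T^r]g ≠ 0` pin
`rank = ord_T g = r`; clause 2 gives Schneider and `Ш[p^∞]` finite; clause 3 in norms reads
`p^{-r} = ‖#Ш[p^∞]‖ · ‖Reg_p‖` (the factors `u`, `(1−α⁻¹)² ∼ N_p²`, `#tors²`, `∏c_ℓ` being units),
and `‖Reg_p‖ ≤ p^{-r}` forces `‖#Ш[p^∞]‖ = 1`, i.e. `p ∤ #Ш[p^∞]`, i.e. `Ш[p^∞] = 0`.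
[cite: Schneider1985, Thm 2′ (p. 342)] [cite: MazurTate1983Biext, §3.3 and (4.1.1)]
[cite: KunduRay2024, Lemma 3.4 and Thm 3.6] [cite: SteinWuthrich2013, Thm 6.1 and §4.4] -/
theorem lambdaDoorKernel (h85 : Schneider1985_order_charGenerator_odd)
    (hp : 3 ≤ p) (hord : IsOrdinaryAt W p)
    (hna : ¬ (p : ℤ) ∣ W.frobeniusTrace p - 1) (hTam : ¬ p ∣ W.tamagawaProduct)
    {κ : ZpExtension ℚ p} {γ : Field.absoluteGaloisGroup ℚ}
    (hκ : κ.IsCyclotomic) (hγ : κ.IsTopGenerator γ) (hγ' : IsCyclotomicVariable p γ)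
    (D : W.SelmerDualData κ γ) [Module.Finite (IwasawaAlgebra p) D.X] (hX : D.IsTorsion)
    {g : IwasawaAlgebra p} (hchar : D.charIdeal = Ideal.span {g})
    {Dh : PAdicHeightData W p} (hDh : Dh.IsCanonical)
    (hint : ∀ P Q : W.toAffine.Point, ‖Dh.pairing P Q‖ ≤ (p : ℝ)⁻¹)
    {r : ℕ} (hr : r ≤ W.mordellWeilRank) (hunit : IsUnit (PowerSeries.coeff r g)) :
    W.mordellWeilRank = r ∧ g.order = r ∧ AddCommGroup.primaryComponent W.sha p = ⊥ ∧
      SchneiderConjecture Dh ∧ ‖padicRegulator Dh‖ = (p : ℝ)⁻¹ ^ r := by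
  have hpp : p.Prime := Fact.out
  have hp2 : p ≠ 2 := by omega
  have hp0 : (0 : ℝ) < (p : ℝ)⁻¹ := by positivity
  obtain ⟨h1, h2, h3⟩ := h85 W p hp2 hord.1 hord.2 κ γ hκ hγ hγ' D hX g hchar Dh hDh
  -- Step 1: `rank = ord_T g = r`
  have hord_le : g.order ≤ r := PowerSeries.order_le r hunit.ne_zero
  have hrank : W.mordellWeilRank = r :=
    le_antisymm (by exact_mod_cast h1.trans hord_le) hr
  subst hrank
  have horder : g.order = W.mordellWeilRank := le_antisymm hord_le h1
  -- Step 2: Schneider and `Ш[p^∞]` finite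
  obtain ⟨hS, hfin⟩ := h2.mp horder
  haveI := hfin
  -- Step 3: the leading-term identity in norms
  obtain ⟨u, hu⟩ := h3 hS hfin
  have hcoeff : ‖((PowerSeries.coeff W.mordellWeilRank g : ℤ_[p]) : ℚ_[p])‖ = 1 := by
    rw [PadicInt.padic_norm_e_of_padicInt]; exact PadicInt.isUnit_iff.mp hunit
  have hlog : ‖padicLog p (cyclotomicGenerator p : ℚ_[p])‖ = (p : ℝ)⁻¹ := by
    obtain ⟨v, hv⟩ := exists_unit_padicLog_cyclotomicGenerator p hp2
    rw [hv, norm_mul, Padic.norm_p, PadicInt.padic_norm_e_of_padicInt,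
      PadicInt.isUnit_iff.mp v.isUnit, mul_one]
  have htors : ‖(W.torsionOrder : ℚ_[p])‖ = 1 :=
    Padic.norm_natCast_eq_one_iff.mpr ((Nat.Prime.coprime_iff_not_dvd hpp).mpr
      (not_dvd_torsionOrder_of_not_dvd_frobeniusTrace_sub_one W p hp hord.1 hna))
  have hu1 : ‖((u : ℤ_[p]) : ℚ_[p])‖ = 1 := by
    rw [PadicInt.padic_norm_e_of_padicInt]; exact PadicInt.isUnit_iff.mp u.isUnit
  have halpha : ‖(1 - ((unitRoot W p : ℤ_[p]) : ℚ_[p])⁻¹)‖ = 1 := by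
    obtain ⟨v, hv⟩ := exists_unit_one_sub_unitRoot_inv p W hord
    have hN : ‖(W.reductionPointCount p : ℚ_[p])‖ = 1 :=
      Padic.norm_natCast_eq_one_iff.mpr ((Nat.Prime.coprime_iff_not_dvd hpp).mpr fun h ↦
        hna ((dvd_reductionPointCount_iff_dvd_frobeniusTrace_sub_one W p).mp h))
    rw [hv, norm_mul, PadicInt.padic_norm_e_of_padicInt, PadicInt.isUnit_iff.mp v.isUnit, hN,
      mul_one]
  have hTam1 : ‖(W.tamagawaProduct : ℚ_[p])‖ = 1 :=
    Padic.norm_natCast_eq_one_iff.mpr ((Nat.Prime.coprime_iff_not_dvd hpp).mpr hTam)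
  have hSha_le : ‖(Nat.card (AddCommGroup.primaryComponent W.sha p) : ℚ_[p])‖ ≤ 1 := by
    exact_mod_cast Padic.norm_int_le_one (p := p) (Nat.card (AddCommGroup.primaryComponent W.sha p) : ℤ)
  have hReg_le : ‖padicRegulator Dh‖ ≤ (p : ℝ)⁻¹ ^ W.mordellWeilRank :=
    norm_padicRegulator_le_of_forall_norm_pairing_le W p hint
  -- norms of both sides of clause 3: `p^{-r} = ‖#Ш‖ · ‖Reg‖`
  have hmain : (p : ℝ)⁻¹ ^ W.mordellWeilRank =
      ‖(Nat.card (AddCommGroup.primaryComponent W.sha p) : ℚ_[p])‖ * ‖padicRegulator Dh‖ := by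
    have hnorm := congrArg (fun z : ℚ_[p] ↦ ‖z‖) hu
    simp only [norm_mul, norm_pow, hcoeff, hlog, htors, hu1, halpha, hTam1, one_mul, mul_one,
      one_pow] at hnorm
    exact hnorm
  have hSha1 : ‖(Nat.card (AddCommGroup.primaryComponent W.sha p) : ℚ_[p])‖ = 1 := by
    refine le_antisymm hSha_le (le_of_mul_le_mul_right ?_ (pow_pos hp0 W.mordellWeilRank))
    rw [one_mul]
    calc (p : ℝ)⁻¹ ^ W.mordellWeilRank
        = ‖(Nat.card (AddCommGroup.primaryComponent W.sha p) : ℚ_[p])‖ * ‖padicRegulator Dh‖ := hmain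
      _ ≤ ‖(Nat.card (AddCommGroup.primaryComponent W.sha p) : ℚ_[p])‖ *
            (p : ℝ)⁻¹ ^ W.mordellWeilRank := mul_le_mul_of_nonneg_left hReg_le (norm_nonneg _)
  have hReg : ‖padicRegulator Dh‖ = (p : ℝ)⁻¹ ^ W.mordellWeilRank := by
    rw [hSha1, one_mul] at hmain; exact hmain.symm
  have hSha : AddCommGroup.primaryComponent W.sha p = ⊥ :=
    primaryComponent_sha_eq_bot_of_not_dvd_natCard W p
      ((Nat.Prime.coprime_iff_not_dvd hpp).mp (Padic.norm_natCast_eq_one_iff.mp hSha1))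
  exact ⟨rfl, horder, hSha, hS, hReg⟩

/-- **The converse half** (same hypotheses on the member): if `Ш(E/ℚ)[p^∞] = 0` and the canonical
regulator has the minimal valuation allowed by integrality, `‖Reg_p(Dh)‖ = p^{-rank}` (`𝓡_p ∈ ℤ_pˣ`),
then `[T^{rank}] g ∈ ℤ_pˣ`, i.e. `g = T^{rank} · unit` (`μ = 0 ∧ λ(g) = rank`). So on the class
`𝒞_p` the λ-certificate `μ = 0 ∧ λ = rank` is EQUIVALENT to `Ш[p^∞] = 0 ∧ 𝓡_p ∈ ℤ_pˣ` — the CM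
prototype is Perrin-Riou's criterion (Coates 1983, Thm 17/Thm 24). [cite: Schneider1985, Thm 2′ (p. 342)]
[cite: Coates1983InfiniteDescent, Thm 17 and Thm 24] -/
theorem isUnit_coeff_of_sha_eq_bot_of_norm_padicRegulator_eq
    (h85 : Schneider1985_order_charGenerator_odd)
    (hp : 3 ≤ p) (hord : IsOrdinaryAt W p)
    (hna : ¬ (p : ℤ) ∣ W.frobeniusTrace p - 1) (hTam : ¬ p ∣ W.tamagawaProduct)
    {κ : ZpExtension ℚ p} {γ : Field.absoluteGaloisGroup ℚ}
    (hκ : κ.IsCyclotomic) (hγ : κ.IsTopGenerator γ) (hγ' : IsCyclotomicVariable p γ)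
    (D : W.SelmerDualData κ γ) [Module.Finite (IwasawaAlgebra p) D.X] (hX : D.IsTorsion)
    {g : IwasawaAlgebra p} (hchar : D.charIdeal = Ideal.span {g})
    {Dh : PAdicHeightData W p} (hDh : Dh.IsCanonical)
    (hSha : AddCommGroup.primaryComponent W.sha p = ⊥)
    (hReg : ‖padicRegulator Dh‖ = (p : ℝ)⁻¹ ^ W.mordellWeilRank) :
    IsUnit (PowerSeries.coeff W.mordellWeilRank g) ∧ g.order = W.mordellWeilRank := by
  have hpp : p.Prime := Fact.out
  have hp2 : p ≠ 2 := by omega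
  have hp0 : (0 : ℝ) < (p : ℝ)⁻¹ := by positivity
  obtain ⟨-, h2, h3⟩ := h85 W p hp2 hord.1 hord.2 κ γ hκ hγ hγ' D hX g hchar Dh hDh
  have hfin : Finite (AddCommGroup.primaryComponent W.sha p) := by rw [hSha]; infer_instance
  have hS : SchneiderConjecture Dh := by
    intro h0
    rw [h0, norm_zero] at hReg
    exact (pow_pos hp0 _).ne' hReg.symm
  have horder : g.order = W.mordellWeilRank := h2.mpr ⟨hS, hfin⟩
  obtain ⟨u, hu⟩ := h3 hS hfin
  have hlog : ‖padicLog p (cyclotomicGenerator p : ℚ_[p])‖ = (p : ℝ)⁻¹ := by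
    obtain ⟨v, hv⟩ := exists_unit_padicLog_cyclotomicGenerator p hp2
    rw [hv, norm_mul, Padic.norm_p, PadicInt.padic_norm_e_of_padicInt,
      PadicInt.isUnit_iff.mp v.isUnit, mul_one]
  have htors : ‖(W.torsionOrder : ℚ_[p])‖ = 1 :=
    Padic.norm_natCast_eq_one_iff.mpr ((Nat.Prime.coprime_iff_not_dvd hpp).mpr
      (not_dvd_torsionOrder_of_not_dvd_frobeniusTrace_sub_one W p hp hord.1 hna))
  have hu1 : ‖((u : ℤ_[p]) : ℚ_[p])‖ = 1 := by
    rw [PadicInt.padic_norm_e_of_padicInt]; exact PadicInt.isUnit_iff.mp u.isUnit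
  have halpha : ‖(1 - ((unitRoot W p : ℤ_[p]) : ℚ_[p])⁻¹)‖ = 1 := by
    obtain ⟨v, hv⟩ := exists_unit_one_sub_unitRoot_inv p W hord
    have hN : ‖(W.reductionPointCount p : ℚ_[p])‖ = 1 :=
      Padic.norm_natCast_eq_one_iff.mpr ((Nat.Prime.coprime_iff_not_dvd hpp).mpr fun h ↦
        hna ((dvd_reductionPointCount_iff_dvd_frobeniusTrace_sub_one W p).mp h))
    rw [hv, norm_mul, PadicInt.padic_norm_e_of_padicInt, PadicInt.isUnit_iff.mp v.isUnit, hN,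
      mul_one]
  have hTam1 : ‖(W.tamagawaProduct : ℚ_[p])‖ = 1 :=
    Padic.norm_natCast_eq_one_iff.mpr ((Nat.Prime.coprime_iff_not_dvd hpp).mpr hTam)
  have hSha1 : ‖(Nat.card (AddCommGroup.primaryComponent W.sha p) : ℚ_[p])‖ = 1 := by
    have : Nat.card (AddCommGroup.primaryComponent W.sha p) = 1 := by
      rw [hSha]; exact AddSubgroup.card_bot
    rw [this, Nat.cast_one, norm_one]
  have hnorm := congrArg (fun z : ℚ_[p] ↦ ‖z‖) hu
  simp only [norm_mul, norm_pow, hlog, htors, hu1, halpha, hTam1, hSha1, hReg, one_mul, mul_one,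
    one_pow] at hnorm
  -- `hnorm : ‖coeff‖ * p^{-r} = p^{-r}`
  have hc : ‖((PowerSeries.coeff W.mordellWeilRank g : ℤ_[p]) : ℚ_[p])‖ = 1 := by
    have hne : (p : ℝ)⁻¹ ^ W.mordellWeilRank ≠ 0 := (pow_pos hp0 _).ne'
    calc ‖((PowerSeries.coeff W.mordellWeilRank g : ℤ_[p]) : ℚ_[p])‖
        = ‖((PowerSeries.coeff W.mordellWeilRank g : ℤ_[p]) : ℚ_[p])‖ *
            (p : ℝ)⁻¹ ^ W.mordellWeilRank / (p : ℝ)⁻¹ ^ W.mordellWeilRank := by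
          rw [mul_div_cancel_right₀ _ hne]
      _ = 1 := by rw [hnorm, div_self hne]
  refine ⟨PadicInt.isUnit_iff.mpr ?_, horder⟩
  rwa [PadicInt.padic_norm_e_of_padicInt] at hc

/-- **The λ-door via Skinner–Urban with surjective `ρ_{E,p^∞}`** (exact main conjecture:
`char X = (g)`, `ι g = L_p(f, α; T)`; modulo the named facts `Schneider1985_order_charGenerator_odd`,
`mazur_tate_sigma_exists_odd`, `skinner_urban_main_conjecture W p`). For `W/ℚ` globally minimal,
`p ≥ 3` good ordinary NON-ANOMALOUS with `p ∤ ∏ c_ℓ` and `p ∤ [E(ℚ) : E(ℚ) ∩ E⁰(ℚ_ℓ)]` for all `ℓ`,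
`ρ_{E,p^n}` surjective for all `n`, an auxiliary multiplicative prime `ℓ ≠ p` with `p ∤ v_ℓ(Δ_min)`,
and `r ≤ rank E(ℚ)`: if the `p`-adic `L`-function of the newform `f` of `W` has `‖[T^r] L_p‖ = 1`
(`μ = 0 ∧ λ_an = r`), then `rank E(ℚ) = r = ord_T L_p`, `Ш(E/ℚ)[p^∞] = 0`, and for THE canonical
height `Reg_p ≠ 0` with `‖Reg_p‖ = p^{-r}`. [cite: SkinnerUrban2014, Thm 3.29]
[cite: Schneider1985, Thm 2′ (p. 342)] [cite: MazurTate1983Biext, §3.3 and (4.1.1)] -/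
theorem lambdaDoorKernel_SU (h85 : Schneider1985_order_charGenerator_odd)
    (hex : mazur_tate_sigma_exists_odd)
    {κ : ZpExtension ℚ p} {γ : Field.absoluteGaloisGroup ℚ} {N : ℕ} [NeZero N]
    {f : CuspForm (Gamma0 N) 2}
    (hSU : skinner_urban_main_conjecture W p (κ := κ) (γ := γ) (f := f))
    (hp : 3 ≤ p) (hord : IsOrdinaryAt W p)
    (hna : ¬ (p : ℤ) ∣ W.frobeniusTrace p - 1) (hTam : ¬ p ∣ W.tamagawaProduct)
    (hidx : ∀ (ℓ : ℕ) [Fact ℓ.Prime], ¬ p ∣ (W.nonsingularReductionSubgroupAt ℓ).index)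
    (hirr : W.HasIrreducibleModPGaloisRep p) (hsurj : ∀ n : ℕ, W.HasSurjectiveModNGaloisRep (p ^ n))
    (haux : ∃ ℓ : ℕ, ∃ _ : Fact ℓ.Prime, ℓ ≠ p ∧ W.HasMultiplicativeReductionAtPrime ℓ ∧
      ¬ p ∣ padicValInt ℓ W.minimalDiscriminantInt)
    (hκ : κ.IsCyclotomic) (hγ : κ.IsTopGenerator γ) (hγ' : IsCyclotomicVariable p γ)
    (hf : IsNewformOf W f) (D : W.SelmerDualData κ γ) [Module.Finite (IwasawaAlgebra p) D.X]
    {r : ℕ} (hr : r ≤ W.mordellWeilRank)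
    (hL : ‖PowerSeries.coeff r (padicLFunction f (unitRoot W p : ℚ_[p]))‖ = 1) :
    W.mordellWeilRank = r ∧ (padicLFunction f (unitRoot W p : ℚ_[p])).order = r ∧
      AddCommGroup.primaryComponent W.sha p = ⊥ ∧
      ∃ Dh : PAdicHeightData W p, Dh.IsCanonical ∧ SchneiderConjecture Dh ∧
        ‖padicRegulator Dh‖ = (p : ℝ)⁻¹ ^ r := by
  have hp2 : p ≠ 2 := by omega
  obtain ⟨hX, -, hexact⟩ := hSU hp hord.1 hord.2 hirr haux hκ hγ hγ' hf D
  obtain ⟨g, hιg, hchar⟩ := hexact hsurj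
  obtain ⟨Dh, hDh, -⟩ := existsUnique_isCanonical_of_odd hex W p hp2 hord.1 hord.2
  have hint := norm_pairing_le_of_not_anomalous W p hp hord.1 hna hidx hDh
  -- `[T^r] g` is a unit: its image in `ℚ_p` is `[T^r] L_p`, of norm `1`
  have hcoeff : ((PowerSeries.coeff r g : ℤ_[p]) : ℚ_[p]) =
      PowerSeries.coeff r (padicLFunction f (unitRoot W p : ℚ_[p])) := by
    have h : PowerSeries.coeff r (iwasawaToPowerSeries p g) =
        algebraMap ℤ_[p] ℚ_[p] (PowerSeries.coeff r g) :=
      PowerSeries.coeff_map (algebraMap ℤ_[p] ℚ_[p]) r g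
    rw [hιg] at h
    exact h.symm
  have hunit : IsUnit (PowerSeries.coeff r g) := by
    refine PadicInt.isUnit_iff.mpr ?_
    rw [← PadicInt.padic_norm_e_of_padicInt, hcoeff, hL]
  obtain ⟨hrank, horder, hSha, hS, hReg⟩ :=
    lambdaDoorKernel W p h85 hp hord hna hTam hκ hγ hγ' D hX hchar hDh hint hr hunit
  refine ⟨hrank, ?_, hSha, Dh, hDh, hS, hReg⟩
  have hιg' : iwasawaToPowerSeries p g =
      PowerSeries.C ((p : ℚ_[p]) ^ (0 : ℤ)) * padicLFunction f (unitRoot W p : ℚ_[p]) := by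
    rw [zpow_zero, map_one, one_mul]; exact hιg
  rw [order_eq_order_of_iwasawaToPowerSeries_eq p hιg', horder]


/-! ### §3. The door with the integrality DISCHARGED, and the unit criterion as an EQUIVALENCE -/

/-- **THE λ-DOOR KERNEL, integrality discharged** (modulo `Schneider1985_order_charGenerator_odd`
only). For `W/ℚ` globally minimal elliptic, `p ≥ 3` good ordinary with `a_p ≢ 1 (mod p)`
(non-anomalous), `p ∤ ∏ c_ℓ` and `p ∤ [E(ℚ) : E(ℚ) ∩ E⁰(ℚ_ℓ)]` for every prime `ℓ`, `char X = (g)`,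
`Dh` THE canonical height, `r ≤ rank E(ℚ)`, `[T^r] g ∈ ℤ_pˣ`: `rank = r = ord_T g`, `Ш(E/ℚ)[p^∞] = 0`,
Schneider's conjecture, `‖Reg_p(Dh)‖ = p^{-r}`; the `p`-integrality of `⟨·,·⟩_{Dh}` is the Literature
theorem `WeierstrassCurve.norm_pairing_le_of_not_anomalous` (Mazur–Tate 1983 §3.3 for `E/ℚ`).
[cite: MazurTate1983Biext, §3.3 and (4.1.1)] [cite: Schneider1985, Thm 2′ (p. 342)] -/
theorem lambdaDoorKernel_of_not_anomalous (h85 : Schneider1985_order_charGenerator_odd)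
    (hp : 3 ≤ p) (hord : IsOrdinaryAt W p)
    (hna : ¬ (p : ℤ) ∣ W.frobeniusTrace p - 1) (hTam : ¬ p ∣ W.tamagawaProduct)
    (hidx : ∀ (ℓ : ℕ) [Fact ℓ.Prime], ¬ p ∣ (W.nonsingularReductionSubgroupAt ℓ).index)
    {κ : ZpExtension ℚ p} {γ : Field.absoluteGaloisGroup ℚ}
    (hκ : κ.IsCyclotomic) (hγ : κ.IsTopGenerator γ) (hγ' : IsCyclotomicVariable p γ)
    (D : W.SelmerDualData κ γ) [Module.Finite (IwasawaAlgebra p) D.X] (hX : D.IsTorsion)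
    {g : IwasawaAlgebra p} (hchar : D.charIdeal = Ideal.span {g})
    {Dh : PAdicHeightData W p} (hDh : Dh.IsCanonical)
    {r : ℕ} (hr : r ≤ W.mordellWeilRank) (hunit : IsUnit (PowerSeries.coeff r g)) :
    W.mordellWeilRank = r ∧ g.order = r ∧ AddCommGroup.primaryComponent W.sha p = ⊥ ∧
      SchneiderConjecture Dh ∧ ‖padicRegulator Dh‖ = (p : ℝ)⁻¹ ^ r :=
  lambdaDoorKernel W p h85 hp hord hna hTam hκ hγ hγ' D hX hchar hDh
    (norm_pairing_le_of_not_anomalous W p hp hord.1 hna hidx hDh) hr hunit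

/-- **The Perrin-Riou–Schneider unit criterion as an EQUIVALENCE** (non-CM `E/ℚ`; the CM prototype is
Perrin-Riou 1982/84 as reported in Coates 1983, Thm 17 / Thm 24). On the class
`𝒞_p = {p ≥ 3 good ordinary, a_p ≢ 1 (mod p), p ∤ ∏ c_ℓ, p ∤ [E(ℚ) : E(ℚ) ∩ E⁰(ℚ_ℓ)] ∀ℓ}`, for
`char X(E/ℚ_∞) = (g)` and THE canonical height `Dh`:
`[T^{rank}] g ∈ ℤ_pˣ` (⟺ `g ∈ T^{rank}·Λˣ` ⟺ `μ = 0 ∧ λ = rank`) **if and only if**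
`Ш(E/ℚ)[p^∞] = 0 ∧ ‖Reg_p(Dh)‖ = p^{-rank}` (Kundu–Ray's `𝓡_p ∈ ℤ_pˣ`), modulo `Schneider1985_order_charGenerator_odd`.
[cite: Schneider1985, Thm 2′ (p. 342)] [cite: Coates1983InfiniteDescent, Thm 17 and Thm 24]
[cite: KunduRay2024, Lemma 3.4 and Thm 3.6] [cite: MazurTate1983Biext, §3.3 and (4.1.1)] -/
theorem isUnit_coeff_iff_sha_eq_bot_and_norm_padicRegulator_eq
    (h85 : Schneider1985_order_charGenerator_odd)
    (hp : 3 ≤ p) (hord : IsOrdinaryAt W p)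
    (hna : ¬ (p : ℤ) ∣ W.frobeniusTrace p - 1) (hTam : ¬ p ∣ W.tamagawaProduct)
    (hidx : ∀ (ℓ : ℕ) [Fact ℓ.Prime], ¬ p ∣ (W.nonsingularReductionSubgroupAt ℓ).index)
    {κ : ZpExtension ℚ p} {γ : Field.absoluteGaloisGroup ℚ}
    (hκ : κ.IsCyclotomic) (hγ : κ.IsTopGenerator γ) (hγ' : IsCyclotomicVariable p γ)
    (D : W.SelmerDualData κ γ) [Module.Finite (IwasawaAlgebra p) D.X] (hX : D.IsTorsion)
    {g : IwasawaAlgebra p} (hchar : D.charIdeal = Ideal.span {g})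
    {Dh : PAdicHeightData W p} (hDh : Dh.IsCanonical) :
    IsUnit (PowerSeries.coeff W.mordellWeilRank g) ↔
      (AddCommGroup.primaryComponent W.sha p = ⊥ ∧
        ‖padicRegulator Dh‖ = (p : ℝ)⁻¹ ^ W.mordellWeilRank) := by
  constructor
  · intro hunit
    obtain ⟨-, -, hSha, -, hReg⟩ := lambdaDoorKernel_of_not_anomalous W p h85 hp hord hna hTam hidx
      hκ hγ hγ' D hX hchar hDh le_rfl hunit
    exact ⟨hSha, hReg⟩
  · rintro ⟨hSha, hReg⟩
    exact (isUnit_coeff_of_sha_eq_bot_of_norm_padicRegulator_eq W p h85 hp hord hna hTam hκ hγ hγ'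
      D hX hchar hDh hSha hReg).1

end Door

end Summit.BirchSwinnertonDyer.Rank2

end
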